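import Literature.GroupTheory.CombinatorialGroupTheory.RandomSclFreeGroup
import Literature.Computability.Complexity.PRelSigmaPi
import Literature.Computability.Complexity.OracleProofs
import Literature.Computability.Complexity.NondeterministicProofs
import HarnessLib

/-!
# Computing commutator length in a free group is NP-complete (Heuer 2020)

N. Heuer, *Computing commutator length is hard*, arXiv:2001.10230 [Heuer2020] (text held and read:
`lit read arxiv:2001.10230`, §1, §2.3.1, §3.3, §4, §5).

**The printed decision problem** (loc. cit. §1, Definition "CL-`G`"): "Let `G` be a group with
generating set `S`, let `g̃ ∈ F(S)` be a word representing an element `g ∈ [G,G]` and let `k ∈ ℕ`.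
Then the decision problem which determines if `cl_G(g) ≤ k` is called CL-`G`. The input has size
`|g̃| + k`." Here `cl_G(g)` is the commutator length (tree: `commutatorLength`, the least number
of commutators `[x, y] = x y x⁻¹ y⁻¹` with product `g`).

**The printed theorem** (loc. cit. Theorem 1, first part): "Let `G` be a non-abelian free group.
Then the decision problem CL-`G` is NP-complete." Proof (loc. cit. §5): CL-`F(A)` is in NP by
Corollary 2.5 (certificate = a Bardakov pairing, orbit counting is linear time; Bardakov's
formula is loc. cit. Thm. 2.4 [Bardakov2000]); it is NP-hard by
Theorem 3 (the cyclic block interchange problem CBI-`A` is NP-complete for `|A| ≥ 2`, by a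
many-one reduction from 3-PARTITION [GareyJohnson1979] for `|A| = 4`, §4.1, and the encoding
`λ` into binary alphabets, Lemma 4.6) combined with Theorem 2 (ii) ("there is a polynomial time
reduction from CBI-`A` to CL-`F(A)`").

**What kind of reduction Theorem 2 (ii) is.** Its proof (loc. cit. §3.3) rests on Claim 3.11,
`cl(v + w⁻¹) = min { cl(v w̃⁻¹) : w̃ a cyclic conjugate of w }`, and concludes: "in time `|w|` we
may decide `cl(v + w⁻¹) ≤ n`, using the decision problem CL-`F(A)`" — i.e. the instance
`(v, w, n)` of CBI is decided by `|w|` calls to CL (one per cyclic conjugate), accepting iff one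
of them accepts. This is a polynomial-time *Turing* (Cook; indeed disjunctive truth-table)
reduction, not a single many-one (Karp) map, and the paper does not define "NP-complete". The
named fact below therefore records EXACTLY what the printed proof establishes and what every
reading of "NP-complete" implies: membership in `NP` and NP-hardness under polynomial-time
Turing reductions (tree: `PolyTimeTuringReducible L A := L ∈ PRel (Oracle.ofLanguage A)`,
`Oracle.lean`). Karp NP-completeness (tree: `IsNPComplete`) implies it
(`Heuer2020_clNPComplete.of_isNPComplete`, via the proved `PolyTimeKarpReducible.turing_holds`)
and is NOT asserted here. For the intended use — "CL-`F` in `P` forces `P = NP`" — the Cook form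
is exactly as strong (`Heuer2020_clNPComplete.NP_subset_P_of_mem_P`, proved from the tree's
`PRelClass_P_subset_P`, i.e. `P^P = P`).

**Formalisation choices** (each a specialisation of, or forced by, the printed text):
* `G = FreeGroup (Fin r)` with `2 ≤ r` (every finite-rank non-abelian free group; Cor. 2.5
  measures input size "in the wordlength of a free basis", so `S` = the free basis `Fin r`).
  Infinite rank is not stated (its letters have no fixed-width code); nothing printed is lost for
  the hub's use (`r = 2`).
* An instance is a pair `(w, k)`: `w : List (Fin r × Bool)` ANY word in the letters `a^{±1}`
  (Mathlib's `FreeGroup` letters, `(a, true) = a`, `(a, false) = a⁻¹`; not required to be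
  reduced — `FreeGroup.mk w` is the element it represents) and `k : ℕ`. Yes-instances
  (`clDecisionSet`): `FreeGroup.mk w ∈ [F, F]` and `cl(FreeGroup.mk w) ≤ k` — the set
  `{(g, k) : g ∈ [G,G], cl_G(g) ≤ k}`; words outside the commutator subgroup are no-instances
  (`commutatorLength` has junk value `0` there, so the membership conjunct is essential).
* Strings (`clInstanceCode`): `boolPair (clWordCode w) (unaryEncodeNat k)` — the word in a
  fixed-width letter code (`clLetterCode`: one-hot generator index of width `r`, then the sign bit)
  and `k` in UNARY, matching "the input has size `|g̃| + k`"; `boolPair`/`unaryEncodeNat` are the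
  tree's/Mathlib's (the same pairing and unary threshold as route `PneNP/BavardGap`).
  `clInstanceCode_injective`, `clInstanceCode_mem_clLanguage_iff`.

## Contents
* `clDecisionSet`, `clLetterCode`, `clWordCode`, `clInstanceCode`, `clLanguage` — the language CL-`F_r`;
* `Heuer2020_clNPComplete` — the NAMED FACT (Theorem 1 with Cor. 2.5, in the Cook form above);
* proved API: injectivity / membership lemmas, two sanity instances, `.mem_NP`, `.hard`,
  `.of_isNPComplete`, `.NP_subset_P_of_mem_P`, `.P_eq_NP_of_mem_P`.

## Not here
The second part of Theorem 1 (no polynomial-time algorithm computing `cl_G` for groups with a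
retract onto a non-abelian free group unless `P = NP`), Theorem 2 (i) (`d_cbi = cl(v + w⁻¹)`),
Theorem 3 (CBI NP-complete), Prop. 2.7 (CL for fixed `k` is in `P`), Theorem 2.8 (chains,
[Kharlampovich–Lysënok–Myasnikov–Touikan]) and Bardakov's formula itself (Thm. 2.4), which is
vendored separately in this directory (pairings, orbit counts).
-/

namespace Literature.GroupTheory.CombinatorialGroupTheory

open _root_.Computability Literature.Computability.Complexity

/-! ### The decision problem CL-`F_r` as a language over `{0,1}` -/

/-- Yes-instances of CL-`F_r` ([Heuer2020, §1, Definition CL-`G`] with `G = F(Fin r)`): pairs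
`(w, k)` of a word `w` in the letters `a^{±1}`, `a : Fin r`, and `k : ℕ` such that the element
`FreeGroup.mk w` lies in the commutator subgroup and has commutator length `≤ k`.
[cite: Heuer2020, §1 (Definition CL-G)] -/
def clDecisionSet (r : ℕ) : Set (List (Fin r × Bool) × ℕ) :=
  {p | FreeGroup.mk p.1 ∈ commutator (FreeGroup (Fin r)) ∧ commutatorLength (FreeGroup.mk p.1) ≤ p.2}

/-- Unfolding of `clDecisionSet`. [cite: Heuer2020, §1 (Definition CL-G)] -/
theorem mem_clDecisionSet_iff {r : ℕ} (p : List (Fin r × Bool) × ℕ) :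
    p ∈ clDecisionSet r ↔
      FreeGroup.mk p.1 ∈ commutator (FreeGroup (Fin r)) ∧ commutatorLength (FreeGroup.mk p.1) ≤ p.2 :=
  Iff.rfl

/-- Fixed-width binary code of a letter `a^{ε}` of `F(Fin r)`: the one-hot vector of the
generator index `a` (width `r`) followed by the sign bit `ε`; width `r + 1`. (Any fixed-width
injective letter code would do; the source measures input size in the word length.) [folklore] -/
def clLetterCode (r : ℕ) (x : Fin r × Bool) : List Bool :=
  List.ofFn (fun j : Fin r => decide (x.1 = j)) ++ [x.2]

/-- The code of a word: concatenation of the codes of its letters (length `(r + 1) · |w|`). [folklore] -/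
def clWordCode (r : ℕ) (w : List (Fin r × Bool)) : List Bool :=
  w.flatMap (clLetterCode r)

/-- The string of an instance `(w, k)`: `boolPair (clWordCode w) (unaryEncodeNat k)` — the word in
the fixed-width letter code, self-delimited, then `k` in unary ("the input has size `|g̃| + k`",
[Heuer2020, §1]). [cite: Heuer2020, §1 (Definition CL-G)] -/
def clInstanceCode (r : ℕ) (p : List (Fin r × Bool) × ℕ) : List Bool :=
  boolPair (clWordCode r p.1) (unaryEncodeNat p.2)

/-- The language CL-`F_r ⊆ {0,1}*`: the codes of the yes-instances `clDecisionSet r`.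
[cite: Heuer2020, §1 (Definition CL-G)] -/
def clLanguage (r : ℕ) : Language Bool :=
  clInstanceCode r '' clDecisionSet r

/-! ### Injectivity of the encoding and the membership lemma -/

/-- A letter code has width `r + 1`. [folklore] -/
@[simp] theorem length_clLetterCode (r : ℕ) (x : Fin r × Bool) : (clLetterCode r x).length = r + 1 := by
  simp [clLetterCode]

/-- The letter code is injective. [folklore] -/
theorem clLetterCode_injective (r : ℕ) : Function.Injective (clLetterCode r) := by
  intro x y h
  obtain ⟨h1, h2⟩ := List.append_inj h (by simp)
  have hb : x.2 = y.2 := by simpa using h2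
  have hf := List.ofFn_inj.mp h1
  have ha : decide (x.1 = x.1) = decide (y.1 = x.1) := congrFun hf x.1
  simp only [decide_true, Bool.true_eq, decide_eq_true_eq] at ha
  exact Prod.ext ha.symm hb

/-- The word code is injective (fixed-width blocks). [folklore] -/
theorem clWordCode_injective (r : ℕ) : Function.Injective (clWordCode r) := by
  intro v
  induction v with
  | nil =>
    intro w h
    cases w with
    | nil => rfl
    | cons y w =>
      have := congrArg List.length h
      simp [clWordCode, List.length_flatMap] at this
      omega
  | cons x v ih =>
    intro w h
    cases w with
    | nil =>
      have := congrArg List.length h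
      simp [clWordCode, List.length_flatMap] at this
    | cons y w =>
      simp only [clWordCode, List.flatMap_cons] at h
      obtain ⟨h1, h2⟩ := List.append_inj h (by simp)
      rw [clLetterCode_injective r h1, ih h2]

/-- The instance code is injective (`boolPair` is, and unary is). [folklore] -/
theorem clInstanceCode_injective (r : ℕ) : Function.Injective (clInstanceCode r) := by
  intro p q h
  have h' := boolPair_injective (a₁ := (clWordCode r p.1, unaryEncodeNat p.2))
    (a₂ := (clWordCode r q.1, unaryEncodeNat q.2)) h
  simp only [Prod.mk.injEq] at h'
  refine Prod.ext (clWordCode_injective r h'.1) ?_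
  have := congrArg unaryDecodeNat h'.2
  simpa [unary_decode_encode_nat] using this

/-- Membership of a coded instance in CL-`F_r` is membership in the yes-set. [folklore] -/
@[simp] theorem clInstanceCode_mem_clLanguage_iff {r : ℕ} (p : List (Fin r × Bool) × ℕ) :
    clInstanceCode r p ∈ clLanguage r ↔ p ∈ clDecisionSet r :=
  (clInstanceCode_injective r).mem_set_image

/-- Sanity instance: the empty word with threshold `0` is a yes-instance (`cl(1) = 0`). [folklore] -/
theorem nil_zero_mem_clDecisionSet (r : ℕ) : (([] : List (Fin r × Bool)), 0) ∈ clDecisionSet r := by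
  refine ⟨?_, ?_⟩
  · change FreeGroup.mk [] ∈ commutator (FreeGroup (Fin r))
    rw [← FreeGroup.one_eq_mk]
    exact one_mem _
  · change commutatorLength (FreeGroup.mk []) ≤ 0
    rw [← FreeGroup.one_eq_mk, commutatorLength_one]

/-- Sanity instance: the commutator word `a b a⁻¹ b⁻¹` of `F₂` with threshold `1` is a
yes-instance. [folklore] -/
theorem commutatorWord_one_mem_clDecisionSet :
    ([((0 : Fin 2), true), (1, true), (0, false), (1, false)], 1) ∈ clDecisionSet 2 := by
  have hmk : FreeGroup.mk [((0 : Fin 2), true), (1, true), (0, false), (1, false)] =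
      FreeGroup.of 0 * FreeGroup.of 1 * (FreeGroup.of 0)⁻¹ * (FreeGroup.of 1)⁻¹ := by
    simp [FreeGroup.of, FreeGroup.inv_mk, FreeGroup.invRev]
  refine ⟨?_, ?_⟩
  · rw [hmk]
    simpa using prod_map_commutator_mem [((FreeGroup.of 0 : FreeGroup (Fin 2)), FreeGroup.of 1)]
  · change commutatorLength (FreeGroup.mk _) ≤ 1
    rw [hmk]
    exact commutatorLength_commutatorElement_le _ _

/-! ### The named fact -/

/-- **Computing commutator length in a non-abelian free group is NP-complete**
([Heuer2020, Thm. 1], first part; membership [Heuer2020, Cor. 2.5]; hardness [Heuer2020, Thm. 3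
with Thm. 2 (ii), §5]). Printed: "Let `G` be a non-abelian free group. Then the decision problem
CL-`G` is NP-complete", CL-`G` being "given `g̃ ∈ F(S)` representing `g ∈ [G,G]` and `k ∈ ℕ`,
decide `cl_G(g) ≤ k`; the input has size `|g̃| + k`".

Vendored, for every finite rank `r ≥ 2` (`G = FreeGroup (Fin r)`, free basis `Fin r`, instances
coded by `clInstanceCode`: fixed-width letter code, `k` in unary), as the conjunction of
* `clLanguage r ∈ NP` (Cor. 2.5: the certificate is a pairing, orbits are counted in linear time), and
* every `L ∈ NP` is polynomial-time TURING-reducible to `clLanguage r`: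
  `NP ⊆ PRel (Oracle.ofLanguage (clLanguage r))`, i.e. `∀ L ∈ NP, L ≤ᵀₚ clLanguage r`.
The hardness clause is stated in the Cook form because that is what the printed proof gives:
Thm. 2 (ii) reduces CBI-`A` to CL-`F(A)` by `|w|` oracle calls (§3.3, Claim 3.11: "in time `|w|`
we may decide `cl(v + w⁻¹) ≤ n`, using the decision problem CL-`F(A)`"), composed with the
many-one reductions 3-PARTITION → CBI-`{a,b,c,d}` → CBI-`{x,y}` (§4, Lemma 4.6) and the
NP-completeness of 3-PARTITION [GareyJohnson1979]. Karp NP-completeness (`IsNPComplete`) implies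
this form (`Heuer2020_clNPComplete.of_isNPComplete`) and is not asserted. Consequence proved
below: `clLanguage r ∈ P → P = NP`. [cite: Heuer2020, Thm. 1 and Cor. 2.5] -/
def Heuer2020_clNPComplete : Prop :=
  ∀ r : ℕ, 2 ≤ r →
    clLanguage r ∈ Nondeterministic.NP ∧
      Nondeterministic.NP ⊆ PRel (Oracle.ofLanguage (clLanguage r))

/-! ### Proved consequences and the Karp reading -/

/-- CL-`F_r` is in `NP` (projection of the fact; [Heuer2020, Cor. 2.5]). [cite: Heuer2020, Cor. 2.5] -/
theorem Heuer2020_clNPComplete.mem_NP (h : Heuer2020_clNPComplete) {r : ℕ} (hr : 2 ≤ r) :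
    clLanguage r ∈ Nondeterministic.NP :=
  (h r hr).1

/-- CL-`F_r` is NP-hard under polynomial-time Turing reductions: every `NP` language is in
`P^{CL-F_r}` (projection of the fact). [cite: Heuer2020, Thm. 1] -/
theorem Heuer2020_clNPComplete.hard (h : Heuer2020_clNPComplete) {r : ℕ} (hr : 2 ≤ r)
    {L : Language Bool} (hL : L ∈ Nondeterministic.NP) :
    PolyTimeTuringReducible L (clLanguage r) :=
  (h r hr).2 hL

/-- The Karp reading implies the vendored (Cook) form: if CL-`F_r` is NP-complete under
many-one reductions for every `r ≥ 2` then `Heuer2020_clNPComplete` holds, since a Karp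
reduction is a one-query Cook reduction (`PolyTimeKarpReducible.turing_holds`).
[cite: LadnerLynchSelman1975, §2] -/
theorem Heuer2020_clNPComplete.of_isNPComplete
    (h : ∀ r : ℕ, 2 ≤ r → IsNPComplete (clLanguage r)) : Heuer2020_clNPComplete := by
  intro r hr
  refine ⟨(h r hr).1, fun L hL => ?_⟩
  exact PolyTimeKarpReducible.turing_holds ((h r hr).2 L hL)

/-- **If CL-`F_r` is decidable in polynomial time then `NP ⊆ P`** (for any `r ≥ 2`): every
`L ∈ NP` lies in `P^{CL-F_r} ⊆ P^P = P` (tree: `PRelClass_P_subset_P`). This is the use made of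
Theorem 1 in [Heuer2020, §5] ("Thus we would be able to decide CL-`F(A)` in polynomial time and
thus P=NP"). [cite: Heuer2020, Thm. 1 and §5] -/
theorem Heuer2020_clNPComplete.NP_subset_P_of_mem_P (h : Heuer2020_clNPComplete) {r : ℕ}
    (hr : 2 ≤ r) (hP : clLanguage r ∈ Classes.P) : Nondeterministic.NP ⊆ Classes.P :=
  fun _ hL => PRelClass_P_subset_P (mem_PRelClass_iff.2 ⟨clLanguage r, hP, (h r hr).2 hL⟩)

/-- **If CL-`F_r` is in `P` then `P = NP`** (with the proved inclusion `P ⊆ NP`,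
`P_subset_NP_holds`). [cite: Heuer2020, Thm. 1 and §5] -/
theorem Heuer2020_clNPComplete.P_eq_NP_of_mem_P (h : Heuer2020_clNPComplete) {r : ℕ}
    (hr : 2 ≤ r) (hP : clLanguage r ∈ Classes.P) : Classes.P = Nondeterministic.NP :=
  Set.Subset.antisymm P_subset_NP_holds (h.NP_subset_P_of_mem_P hr hP)

end Literature.GroupTheory.CombinatorialGroupTheory
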